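import Literature.Geometry.MetricEmbeddings.HeisenbergL1Proofs
import Literature.Geometry.MetricEmbeddings.HeisenbergLatticeBump
import HarnessLib

/-!
# Displacement counts on `ℍ(ℤ)`: subadditivity and the discrete Poincaré-type lemma of
Lafforgue–Naor / Naor–Young

Family `pnp`, layer `Literature/Geometry/MetricEmbeddings`; proofs about the vocabulary of
`HeisenbergLatticeBump.lean` (theorems only). Source: A. Naor, R. Young, *Vertical perimeter versus
horizontal perimeter*, Ann. of Math. 188 (2018) = arXiv:1701.00620, §3.1 Lemma 3.4 (arXiv p. 20;
after V. Lafforgue, A. Naor, Israel J. Math. 203 (2014), Lemma 3.4): "for every `p ∈ [1,∞)`, every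
`n ∈ ℕ` […] and every finitely supported `φ : Γ → 𝓜`, we have
`(Σ_{x∈Γ} (1/|B_Σ(n)|) Σ_{y ∈ B_Σ(n)} d_𝓜(φ(xy), φ(x))^p)^{1/p} ≤ n (Σ_{x ∈ Γ} max_{σ ∈ Σ} d_𝓜(φ(xσ),φ(x))^p)^{1/p}`
[…] For every `y ∈ B_Σ(n)` fix `σ_1(y),…,σ_n(y) ∈ Σ ∪ {1_Γ}` such that `y = σ_1(y)⋯σ_n(y)` […] by
the triangle inequality […]".

Here `Γ = ℍ(ℤ) = (ℤ³, heisMul)`, `𝓜 = {0,1}` (indicators of finite sets `Ω`), `p = 1`, where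
`Σ_x |𝟙_Ω(x w) − 𝟙_Ω(x)| = dispCount Ω w`. PROVED:

* the group algebra of `heisMul` / `heisInv` (`heisMul_assoc`, inverses, cancellation, injectivity of
  translations);
* `dispCount_heisMul_le` — SUBADDITIVITY `D(w σ) ≤ D(w) + D(σ)`, `dispCount_heisInv` (`D(w⁻¹) = D(w)`);
* `dispCount_le_of_walk`, `dispCount_le_of_mem_wordBall` — the lemma along a word:
  `D(z) ≤ n (D(a) + D(b))` for `z ∈ 𝓑_n` (telescoping along a shortest walk in the Cayley graph);
* `dispCount_genA_add_genB` (`D(a) + D(b) = |∂_h Ω|` in the counted form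
  `#{(x,σ) ∈ Ω × 𝔖₁ : xσ ∉ Ω}`), `dispCount_center` (`D(cᵗ) = |∂ᵗ_v Ω|` counted), and the summed form
  `sum_dispCount_wordBall_le`: `Σ_{z ∈ 𝓑_n} D(z) ≤ n |𝓑_n| |∂_h Ω|`.

## References

* [NaorYoung2018] A. Naor, R. Young, Ann. of Math. 188 (2018) 171–279, §1 Def. 1.1, §3.1 Lemma 3.4
  (arXiv:1701.00620 pp. 3, 20; arXiv numbering).
-/

noncomputable section

open Finset

namespace Literature.Geometry.MetricEmbeddings

/-! ### The group algebra of `heisMul` -/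

/-- Associativity of the Heisenberg product. [cite: NaorYoung2018, §1] -/
theorem heisMul_assoc (g h k : ℤ × ℤ × ℤ) : heisMul (heisMul g h) k = heisMul g (heisMul h k) := by
  simp only [heisMul, Prod.mk.injEq]
  exact ⟨by ring, by ring, by ring⟩

/-- `g · 1 = g`. [cite: NaorYoung2018, §1] -/
@[simp] theorem heisMul_zero_right (g : ℤ × ℤ × ℤ) : heisMul g (0, 0, 0) = g := by
  obtain ⟨x, y, z⟩ := g; simp [heisMul]

/-- `1 · g = g`. [cite: NaorYoung2018, §1] -/
@[simp] theorem heisMul_zero_left (g : ℤ × ℤ × ℤ) : heisMul (0, 0, 0) g = g := by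
  obtain ⟨x, y, z⟩ := g; simp [heisMul]

/-- `g · g⁻¹ = 1`. [cite: NaorYoung2018, §1] -/
@[simp] theorem heisMul_heisInv (g : ℤ × ℤ × ℤ) : heisMul g (heisInv g) = (0, 0, 0) := by
  obtain ⟨x, y, z⟩ := g
  simp only [heisMul, heisInv, Prod.mk.injEq]
  exact ⟨by ring, by ring, by ring⟩

/-- `g⁻¹ · g = 1`. [cite: NaorYoung2018, §1] -/
@[simp] theorem heisInv_heisMul (g : ℤ × ℤ × ℤ) : heisMul (heisInv g) g = (0, 0, 0) := by
  obtain ⟨x, y, z⟩ := g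
  simp only [heisMul, heisInv, Prod.mk.injEq]
  exact ⟨by ring, by ring, by ring⟩

/-- `(y · w) · w⁻¹ = y`. [cite: NaorYoung2018, §1] -/
@[simp] theorem heisMul_heisMul_heisInv (y w : ℤ × ℤ × ℤ) : heisMul (heisMul y w) (heisInv w) = y := by
  rw [heisMul_assoc, heisMul_heisInv, heisMul_zero_right]

/-- `(y · w⁻¹) · w = y`. [cite: NaorYoung2018, §1] -/
@[simp] theorem heisMul_heisInv_heisMul (y w : ℤ × ℤ × ℤ) : heisMul (heisMul y (heisInv w)) w = y := by
  rw [heisMul_assoc, heisInv_heisMul, heisMul_zero_right]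

/-- `(g⁻¹)⁻¹ = g`. [cite: NaorYoung2018, §1] -/
@[simp] theorem heisInv_heisInv (g : ℤ × ℤ × ℤ) : heisInv (heisInv g) = g := by
  obtain ⟨x, y, z⟩ := g
  simp only [heisInv, Prod.mk.injEq]
  exact ⟨by ring, by ring, by ring⟩

/-- `(w σ)⁻¹ = σ⁻¹ w⁻¹`. [cite: NaorYoung2018, §1] -/
theorem heisInv_heisMul_eq (w σ : ℤ × ℤ × ℤ) :
    heisInv (heisMul w σ) = heisMul (heisInv σ) (heisInv w) := by
  obtain ⟨x, y, z⟩ := w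
  obtain ⟨x', y', z'⟩ := σ
  simp only [heisMul, heisInv, Prod.mk.injEq]
  exact ⟨by ring, by ring, by ring⟩

/-- Right multiplication is injective. [cite: NaorYoung2018, §1] -/
theorem heisMul_left_injective (w : ℤ × ℤ × ℤ) : Function.Injective fun y => heisMul y w := by
  intro y y' h
  have := congrArg (fun u => heisMul u (heisInv w)) h
  simpa using this

/-- The displacement count by the identity vanishes. [cite: NaorYoung2018, §3.1 Lemma 3.4] -/
@[simp] theorem dispCount_zero (Ω : Finset (ℤ × ℤ × ℤ)) : dispCount Ω (0, 0, 0) = 0 := by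
  simp [dispCount, heisInv]

/-- The displacement count is symmetric under `w ↦ w⁻¹`. [cite: NaorYoung2018, §3.1 Lemma 3.4] -/
theorem dispCount_heisInv (Ω : Finset (ℤ × ℤ × ℤ)) (w : ℤ × ℤ × ℤ) :
    dispCount Ω (heisInv w) = dispCount Ω w := by
  simp only [dispCount, heisInv_heisInv]
  ring

/-- **Subadditivity of the displacement count**: `D(w σ) ≤ D(w) + D(σ)` (a `y` displaced by `wσ`
is displaced by `w`, or `y w` is displaced by `σ`). [cite: NaorYoung2018, §3.1 Lemma 3.4] -/
theorem dispCount_heisMul_le (Ω : Finset (ℤ × ℤ × ℤ)) (w σ : ℤ × ℤ × ℤ) :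
    dispCount Ω (heisMul w σ) ≤ dispCount Ω w + dispCount Ω σ := by
  classical
  unfold dispCount
  -- forward displacements
  have h1 : (Ω.filter fun y => heisMul y (heisMul w σ) ∉ Ω).card ≤
      (Ω.filter fun y => heisMul y w ∉ Ω).card + (Ω.filter fun y => heisMul y σ ∉ Ω).card := by
    calc (Ω.filter fun y => heisMul y (heisMul w σ) ∉ Ω).card
        ≤ ((Ω.filter fun y => heisMul y w ∉ Ω) ∪
            (Ω.filter fun y => heisMul y w ∈ Ω ∧ heisMul y (heisMul w σ) ∉ Ω)).card := by
          refine card_le_card fun y hy => ?_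
          simp only [mem_filter, mem_union] at hy ⊢
          by_cases h : heisMul y w ∈ Ω
          · exact Or.inr ⟨hy.1, h, hy.2⟩
          · exact Or.inl ⟨hy.1, h⟩
      _ ≤ (Ω.filter fun y => heisMul y w ∉ Ω).card +
            (Ω.filter fun y => heisMul y w ∈ Ω ∧ heisMul y (heisMul w σ) ∉ Ω).card :=
          card_union_le _ _
      _ ≤ _ := by
          refine add_le_add le_rfl ?_
          refine card_le_card_of_injOn (fun y => heisMul y w) (fun y hy => ?_)
            (fun y _ y' _ h => heisMul_left_injective w h)
          rw [mem_coe, mem_filter] at hy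
          rw [mem_coe, mem_filter]
          exact ⟨hy.2.1, by rw [heisMul_assoc]; exact hy.2.2⟩
  -- backward displacements
  have h2 : (Ω.filter fun x => heisMul x (heisInv (heisMul w σ)) ∉ Ω).card ≤
      (Ω.filter fun x => heisMul x (heisInv w) ∉ Ω).card +
        (Ω.filter fun x => heisMul x (heisInv σ) ∉ Ω).card := by
    rw [heisInv_heisMul_eq]
    calc (Ω.filter fun x => heisMul x (heisMul (heisInv σ) (heisInv w)) ∉ Ω).card
        ≤ ((Ω.filter fun x => heisMul x (heisInv σ) ∉ Ω) ∪
            (Ω.filter fun x => heisMul x (heisInv σ) ∈ Ω ∧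
              heisMul x (heisMul (heisInv σ) (heisInv w)) ∉ Ω)).card := by
          refine card_le_card fun x hx => ?_
          simp only [mem_filter, mem_union] at hx ⊢
          by_cases h : heisMul x (heisInv σ) ∈ Ω
          · exact Or.inr ⟨hx.1, h, hx.2⟩
          · exact Or.inl ⟨hx.1, h⟩
      _ ≤ (Ω.filter fun x => heisMul x (heisInv σ) ∉ Ω).card +
            (Ω.filter fun x => heisMul x (heisInv σ) ∈ Ω ∧
              heisMul x (heisMul (heisInv σ) (heisInv w)) ∉ Ω).card := card_union_le _ _
      _ ≤ (Ω.filter fun x => heisMul x (heisInv σ) ∉ Ω).card +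
            (Ω.filter fun x => heisMul x (heisInv w) ∉ Ω).card := by
          refine add_le_add le_rfl ?_
          refine card_le_card_of_injOn (fun x => heisMul x (heisInv σ)) (fun x hx => ?_)
            (fun x _ x' _ h => heisMul_left_injective (heisInv σ) h)
          rw [mem_coe, mem_filter] at hx
          rw [mem_coe, mem_filter]
          exact ⟨hx.2.1, by rw [heisMul_assoc]; exact hx.2.2⟩
      _ = _ := add_comm _ _
  omega

/-- **The discrete Poincaré-type lemma along a walk**: if `v` is joined to `z` by a walk of
length `L` in the Cayley graph, then `D(z) ≤ D(v) + L · (D(a) + D(b))`.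
[cite: NaorYoung2018, §3.1 Lemma 3.4] -/
theorem dispCount_le_of_walk (Ω : Finset (ℤ × ℤ × ℤ)) {v z : ℤ × ℤ × ℤ} (p : cayleyGraph.Walk v z) :
    dispCount Ω z ≤ dispCount Ω v + p.length * (dispCount Ω genA + dispCount Ω genB) := by
  induction p with
  | nil => simp
  | @cons u u' z' hadj q ih =>
    -- one step: `u' = u σ^{±1}`, `σ ∈ {a, b}`
    have hstep : dispCount Ω u' ≤ dispCount Ω u + (dispCount Ω genA + dispCount Ω genB) := by
      rw [cayleyGraph_adj] at hadj
      obtain ⟨-, hrel⟩ := hadj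
      rw [cayleyGraph_rel_iff, cayleyGraph_rel_iff] at hrel
      rcases hrel with (h | h) | (h | h)
      · rw [h]; exact (dispCount_heisMul_le Ω u genA).trans (by omega)
      · rw [h]; exact (dispCount_heisMul_le Ω u genB).trans (by omega)
      · have e : u' = heisMul u (heisInv genA) := by rw [h, heisMul_heisMul_heisInv]
        rw [e]
        exact (dispCount_heisMul_le Ω u (heisInv genA)).trans (by rw [dispCount_heisInv]; omega)
      · have e : u' = heisMul u (heisInv genB) := by rw [h, heisMul_heisMul_heisInv]
        rw [e]
        exact (dispCount_heisMul_le Ω u (heisInv genB)).trans (by rw [dispCount_heisInv]; omega)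
    rw [SimpleGraph.Walk.length_cons]
    calc dispCount Ω z' ≤ dispCount Ω u' + q.length * (dispCount Ω genA + dispCount Ω genB) := ih
      _ ≤ dispCount Ω u + (dispCount Ω genA + dispCount Ω genB) +
          q.length * (dispCount Ω genA + dispCount Ω genB) := by gcongr
      _ = dispCount Ω u + (q.length + 1) * (dispCount Ω genA + dispCount Ω genB) := by ring

/-- **The discrete Poincaré-type lemma** ([NY18, Lemma 3.4] with `p = 1`, for indicators of
finite sets): for `z` in the word ball of radius `n`, `D(z) ≤ n (D(a) + D(b))`, i.e.
`Σ_y |𝟙_Ω(yz) − 𝟙_Ω(y)| ≤ n Σ_x (|𝟙_Ω(xa) − 𝟙_Ω(x)| + |𝟙_Ω(xb) − 𝟙_Ω(x)|)`; summing over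
`z ∈ 𝓑_n` gives the printed `Σ_y Σ_{z ∈ 𝓑_n} |φ(yz) − φ(y)| ≲ n |𝓑_n| Σ_x (|φ(xa)−φ(x)| + |φ(xb)−φ(x)|)`.
[cite: NaorYoung2018, §3.1 Lemma 3.4] -/
theorem dispCount_le_of_mem_wordBall (Ω : Finset (ℤ × ℤ × ℤ)) {n : ℕ} {z : ℤ × ℤ × ℤ}
    (hz : z ∈ wordBall n) : dispCount Ω z ≤ n * (dispCount Ω genA + dispCount Ω genB) := by
  obtain ⟨p, hp⟩ := hz
  calc dispCount Ω z ≤ dispCount Ω (0, 0, 0) + p.length * (dispCount Ω genA + dispCount Ω genB) :=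
        dispCount_le_of_walk Ω p
    _ = p.length * (dispCount Ω genA + dispCount Ω genB) := by rw [dispCount_zero, zero_add]
    _ ≤ n * (dispCount Ω genA + dispCount Ω genB) := Nat.mul_le_mul_right _ hp

/-- **`D(a) + D(b) = |∂_h Ω|`** in the counted form `#{(x, σ) ∈ Ω × 𝔖₁ : x·σ ∉ Ω}`,
`𝔖₁ = {a, a⁻¹, b, b⁻¹}`. [cite: NaorYoung2018, §1 Def. 1.1] -/
theorem dispCount_genA_add_genB (Ω : Finset (ℤ × ℤ × ℤ)) :
    dispCount Ω genA + dispCount Ω genB =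
      ((Ω ×ˢ ({(1, 0, 0), (-1, 0, 0), (0, 1, 0), (0, -1, 0)} : Finset (ℤ × ℤ × ℤ))).filter
        fun p => heisMul p.1 p.2 ∉ Ω).card := by
  classical
  rw [card_filter, sum_product_right]
  have hne1 : ((1 : ℤ), (0 : ℤ), (0 : ℤ)) ∉ ({(-1, 0, 0), (0, 1, 0), (0, -1, 0)} : Finset (ℤ × ℤ × ℤ)) := by
    decide
  have hne2 : ((-1 : ℤ), (0 : ℤ), (0 : ℤ)) ∉ ({(0, 1, 0), (0, -1, 0)} : Finset (ℤ × ℤ × ℤ)) := by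
    decide
  have hne3 : ((0 : ℤ), (1 : ℤ), (0 : ℤ)) ∉ ({(0, -1, 0)} : Finset (ℤ × ℤ × ℤ)) := by decide
  rw [sum_insert hne1, sum_insert hne2, sum_insert hne3, sum_singleton]
  simp only [dispCount, card_filter, genA, genB, heisInv]
  norm_num
  ring

/-- **`D(cᵗ) = |∂ᵗ_v Ω|`** in the counted form `#{x ∈ Ω : x·cᵗ ∉ Ω} + #{x ∈ Ω : x·c⁻ᵗ ∉ Ω}`.
[cite: NaorYoung2018, §1 Def. 1.1] -/
theorem dispCount_center (Ω : Finset (ℤ × ℤ × ℤ)) (t : ℤ) :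
    dispCount Ω (0, 0, t) = (Ω.filter fun x => (x.1, x.2.1, x.2.2 + t) ∉ Ω).card +
      (Ω.filter fun x => (x.1, x.2.1, x.2.2 - t) ∉ Ω).card := by
  simp only [dispCount, heisInv]
  congr 1
  · congr 1
    ext x
    simp [heisMul]
  · congr 1
    ext x
    simp [heisMul, sub_eq_add_neg]

/-- **Summed form of the discrete Poincaré-type lemma**:
`Σ_{z ∈ 𝓑_n} D(z) ≤ n |𝓑_n| |∂_h Ω|`. [cite: NaorYoung2018, §3.1 Lemma 3.4] -/
theorem sum_dispCount_wordBall_le (Ω : Finset (ℤ × ℤ × ℤ)) (n : ℕ) :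
    ∑ z ∈ (wordBall_finite n).toFinset, dispCount Ω z ≤
      n * (wordBall_finite n).toFinset.card *
        ((Ω ×ˢ ({(1, 0, 0), (-1, 0, 0), (0, 1, 0), (0, -1, 0)} : Finset (ℤ × ℤ × ℤ))).filter
          fun p => heisMul p.1 p.2 ∉ Ω).card := by
  rw [← dispCount_genA_add_genB]
  calc ∑ z ∈ (wordBall_finite n).toFinset, dispCount Ω z
      ≤ ∑ _z ∈ (wordBall_finite n).toFinset, n * (dispCount Ω genA + dispCount Ω genB) :=
        sum_le_sum fun z hz => dispCount_le_of_mem_wordBall Ω ((Set.Finite.mem_toFinset _).mp hz)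
    _ = _ := by rw [sum_const, smul_eq_mul]; ring

/-- `y · (y⁻¹ · g) = g`. [cite: NaorYoung2018, §1] -/
theorem heisMul_heisInv_cancel_left (y g : ℤ × ℤ × ℤ) : heisMul y (heisMul (heisInv y) g) = g := by
  rw [← heisMul_assoc, heisMul_heisInv, heisMul_zero_left]

/-- Left multiplication is injective. [cite: NaorYoung2018, §1] -/
theorem heisMul_right_injective (y : ℤ × ℤ × ℤ) : Function.Injective fun g => heisMul y g := by
  intro g g' h
  have := congrArg (fun u => heisMul (heisInv y) u) h
  simpa only [← heisMul_assoc, heisInv_heisMul, heisMul_zero_left] using this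

end Literature.Geometry.MetricEmbeddings

end
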